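import Mathlib
import HarnessLib
import HarnessLib.Audit
import Summits.QuantumAdvantage.Statement
import Literature.Computability.Complexity.ConstantDepth
import Literature.Computability.Complexity.BoolEncodings
import Literature.Computability.Complexity.Promise
import Literature.Probability.RandomGraphs.LowDegree
import HarnessLib.Audit.Status.Attr

/-!
Route: TwoSquaresLadder

DORMANT since 2026-08-26T13:38:34Z (reconciler: no traction for 7 d (last activity item-proof-filed at 2026-08-19T12:40:33Z); parked, not closed — `ledger route dormant route-QuantumAdvantage-TwoSquaresLadder --off` to reactivate) — unstaffed, not closed; items shared with open routes are served there. `ledger route dormant <id> --off` reactivates.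

# Route TwoSquaresLadder — Fermat's two-squares language as Shor witness — AC⁰ and AC⁰[p] rungs
provable now by end-conditioned minor arcs and Allender–Saks–Shparlinski planting

It suffices to show X = TwoSquaresNotBPP: the Fermat–Landau language S₂ = { bin(N) : N = a² + b² }
(canonical LSB-first numerals) is not in
BPP. S₂ ∈ BQP is a theorem NOW (Shor's discharged `factoring_mem_FBQP_holds` + Mathlib's
`Nat.eq_sq_add_sq_iff`: every q ≡ 3 (4) divides N to an
even power; support TwoSquaresMemBQP), so ⟨S₂, ·, X⟩ inhabits the summit. X is hypothesis-type
(never staffed for proof) and is IMPLIED by the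
hardness of recognising Blum integers among semiprimes N ≡ 1 (4) (support BlumFaceGivesTarget: N =
pq ≡ 1 (4) lies in S₂ iff p ≡ q ≡ 1 (4)).
RECOMBINATION (lens recomb): MobiusLadder's ladder architecture and PROVED Tal/LMN glue +
ArithStatLadder's digit-band lesson (ends = cylinders
are classical, the middle band is where Davenport–Heilbronn died) and its local-obstruction
structure + Shor's banked FBQP theorem, pointed at a
FACTORIZATION-TYPE witness with a plantable congruence obstruction (3 ∥ N ⇒ N ∉ S₂). What the
combination buys that no parent has: BOTH sub-TC⁰
rungs become provable — R0ᶜ "S₂ is AC⁰-unpredictable given its end digits" (bottom and top ⌊n^{1/4}⌋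
bits; cruxes 2–4, new theorem) and R1 "S₂ ∉ AC⁰[p] for every prime p"
(support PlantedModRung, Allender–Saks–Shparlinski planting + half-dimensional sieve) — whereas
MobiusLadder's R1 (λ vs AC⁰[⊕]) and
ArithStatLadder's middle band (DigitRung) are open.
Lean: `Computability.encodingNatBool.toLanguage {N : ℕ | ∃ a b : ℕ, N = a ^ 2 + b ^ 2} ∉
Literature.Computability.Complexity.BPP`

## Assembly
Pure logic, witness form (sorry-free in Sketch.lean and glue.lean, axioms
propext/choice/Quot.sound): TwoSquaresMemBQP puts S₂ in BQP,
TwoSquaresNotBPP keeps it out of BPP, and ⟨S₂, ·, ·⟩ inhabits QuantumAdvantage = ∃ L ∈ BQP, L ∉ BPP.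
Deciding theorem
`closes (h₁ : TwoSquaresMemBQP) (h₂ : TwoSquaresNotBPP) : QuantumAdvantage := ⟨_, h₁, h₂⟩`. The
ranked cruxes are the EARNED ladder under the
top (R0ᶜ = crux 3, derived by support DigitBlindAC0 from cruxes 2 and 4; R1 via PlantedModRung) and,
as in MobiusLadder / ArithStatLadder, are deliberately not hypotheses of `closes`.

Rationale: WHY THIS LINE. A Shor-computable TOTAL language needs two properties for its unconditional ladder to
move: (i) it must be a FACTORIZATION-TYPE function (membership
depends only on exponents and residues mod a fixed M of the prime factors), so that after truncating
Ω(N) ≤ n^{1/3} the Walsh/minor-arc sums are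
sums over ≤ n^{1/3}-fold products of primes and fall to Vinogradov–Vaughan type I/II bounds on
intervals (Harman2007 Thm 2.1, (1.6.1)–(1.6.2)),
while the 2-adic/archimedean main terms (S₂ is biased mod 8 and has density K/√log x, Landau 1908;
MontgomeryVaughan2007 §6.2.1 Ex. 21) are
ABSORBED by conditioning on the bottom and top s = ⌊n^{1/4}⌋ digits instead of being estimated; what
remains are dyadic frequencies T/2^j with j ≥ s, where the 2-adic main term is O(2^{−j}), the
dyadic-major range j ≤ 4s needs only characters mod 2^j (no exceptional zeros; Postnikov–Gallagher
regions, doi:10.1007/BF01425492), the odd-major range is bounded WITH its possible Siegel term by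
the Gauss-sum size √q'·2^{j−ℓ} ≤ 2^{−s} (Landau–Page structure, never the absence of the zero), and
the rest is minor (type I/II);
(ii) it must REJECT a congruence class modulo an odd prime power (3 ∥ N, 7 ∥ N ⇒ N ∉ S₂), so that a
MOD_q computation can be PLANTED in the digits
(r(x) = 1 + Σ xᵢ 2^{6i} ≡ 1 + |x| mod 9, paddings hard-wired ≡ 0 mod 9, OR-amplified;
Allender–Saks–Shparlinski 2001 / Bernasconi–Damm–Shparlinski
for SQUAREFREE and PRIMES) and Smolensky's theorem (Smolensky1987; Jukna2012 Thm 12.27) gives AC⁰[p]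
lower bounds for EVERY p from a density
statement in progressions alone (Iwaniec's half-dimensional sieve, doi:10.4064/aa-29-1-69-95). λ
(MobiusLadder) has (i) but not (ii); IQ3
(ArithStatLadder) has (ii) (9 ∣ d is rejected) but not (i); S₂ has both, is characterised in
Mathlib, and its classical hardness is the 1987
folklore problem "recognise Blum integers without factoring" (van de Graaf–Peralta
doi:10.1007/3-540-48184-2_9 give ZK proofs precisely because
it cannot be checked; Goldwasser–Micali QR setting; Buhler–Wagon 2008 Ex. 4: the classical route to
a² + b² = N runs through factoring N).
Imported areas: sieve/multiplicative number theory (Vaughan identity, half-dimensional sieve,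
Landau–Selberg–Delange, Ramachandra–Huxley short
intervals), Boolean Fourier analysis of AC⁰ (LinialMansourNisan1993, Tal2017, Boppana1997 — PROVED
in tree and already consumed by
`MobiusLadder.ac0_orthogonal_of_uniform_walsh`), Razborov–Smolensky (tree: `smolensky_parity`,
`razborov_smolensky`). Negatives index (5
refutations) untouched: no θ-constants, no frames, no Frobenian claims.

RANKED CRUXES. #0 TwoSquaresNotBPP (target) — the language of sums of two squares (LSB-first
canonical numerals) is not in BPP. Hypothesis-type top (like LiouvilleNotPPoly, IqThreeNotBPP);
implied by Blum-integer-recognition hardness (support BlumFaceGivesTarget); S₂ ≤ FACT, so it implies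
factoring ∉ FBPP. [difficulty: open-problem] (why it might fail: may simply be FALSE: a
factoring-free test for "the 3-mod-4 part of N is a square" (none since Fermat; Cornacchia needs √−1
mod N) would put S₂ in P; no reduction FROM factoring/QR is known either.)
[doi:10.1007/3-540-48184-2_9, doi:10.1017/9781139049801, AdlemanMcCurley1994, Shor1997]
#2 TwoSquaresMinorArcs (crux) — MIDDLE-BAND DYADIC FREQUENCIES OF S₂ ON LONG DYADIC INTERVALS (s :=
⌊n^{1/4}⌋ = Nat.sqrt (Nat.sqrt n)). There is c > 0 such that for all large n, every dyadic interval
I = [a·2^ℓ, (a+1)·2^ℓ) ⊆ [0, 2ⁿ) with n − n^{3/5} ≤ ℓ ≤ n, and every frequency T/2^j with T odd and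
s ≤ j ≤ ℓ − 3s: |Σ_{N∈I} 1_{S₂}(N) e(TN/2^j)| ≤ 2^ℓ · 2^{−n^c} (proof target: 2^{−s}). Three
regimes: (a) dyadic-major s ≤ j ≤ 4s: classes mod 2^j, the 2-adic main term vanishes at odd T beyond
O(2^{ℓ−j}) (class weight transform (e(T/4) − 1)/2^j), errors via characters mod 2^j — no exceptional
zeros, Postnikov–Gallagher regions give relative error 2^{4s}·exp(−c n^{1/3−ε}) → 0; (b) odd-major:
Dirichlet a/q' with q' ≤ 2^{4s}: main + possible Siegel term bounded by √q'·2^{j−ℓ} ≤ 2^{−s} through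
the winding of e(βN) (Landau–Page structure only); (c) minor q' > 2^{4s}: truncate Ω(N) ≤ n^{1/3}
(tail 2^{−n^{1/3}+o}), survivors = ordered prime tuples with the S₂ parity condition (≤ (log
x)^{O(n^{1/3})} configurations), each bounded by short-interval type I/II (Heath-Brown/Vaughan
identity on [A, A+L), L = x^{1−o(1)}: no A/L loss), saving q'^{−1/4} ≤ 2^{−s}. Numerics this session
(n = 20, all odd T, exact FFT): max relative bias ≈ 2^{−(j−1)} for small j and ≈ 0.35·2^{−(ℓ−j)} for
large j (peaks sit at T/2^j ≈ 1/9, 32/49, 35/81, 17/19 — odd-major leakage exactly as in (b)), noise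
floor in between: the band [s, ℓ − 3s] is where both are small. From MobiusLadder: the role of
WalshLiouvilleBound; from ArithStatLadder: this IS the DigitRung middle band, classical here because
the witness is factorization-type. [difficulty: L] (why it might fail: regime (c) needs
SHORT-INTERVAL type I/II bounds (L = x·2^{−n^{3/5}}) uniform over ≤ n^{1/3}-fold prime tuples with
(log x)^{O(n^{1/3})} configurations against a 2^{−n^{1/4}} target; regime (a) needs
Postnikov–Gallagher zero-free regions for (L(s,χ)L(s,χχ₄))^{1/2}, χ mod 2^j.) [Harman2007,
Vaughan1977, MontgomeryVaughan2007, doi:10.1007/BF01425492, Green2012, Bourgain2013MoebiusWalsh]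
#3 TwoSquaresEndOrthogonalAC0 (crux) — R0ᶜ, THE EARNED THEOREM (target of the analytic engine:
support DigitBlindAC0 derives it from cruxes 2 and 4; a prover may also attack it directly): for
every A, depth d and size polynomial p, eventually in n, every AC⁰ circuit C on n digits has
|Σ_{N<2ⁿ} (1_{S₂}(N) − m_n(N))·sgn C(bits N)| ≤ 2ⁿ n^{−A}, where m_n(N) is the proportion of sums of
two squares among the N' < 2ⁿ sharing N's bottom s and top s binary digits, s = ⌊n^{1/4}⌋ (Nat.sqrt
(Nat.sqrt n)): AC⁰ cannot predict S₂ beyond its end digits. [deps: TwoSquaresMinorArcs,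
TwoSquaresShortIntervals] [difficulty: L] (why it might fail: could be FALSE only through a digital
bias of S₂ at a middle-band dyadic frequency (none seen at n = 20); provability rests on cruxes 2, 4
and the banded L² transfer (clustered near-top characters recurse |S| ≤ (log n)^C times).)
[Green2012, Tal2017, Boppana1997]
#4 TwoSquaresShortIntervals (crux) — SHORT-INTERVAL REGULARITY OF LANDAU'S COUNT: for every A,
eventually in n, any two dyadic intervals of equal length 2^ℓ ≥ 2^{n−n^{3/5}} inside [2^{n−1}, 2ⁿ)
at distance ≤ 2^{n−s} (s = ⌊n^{1/4}⌋, i.e. inside one top piece) contain the same number of sums of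
two squares up to 2^ℓ·n^{−A}. In print in spirit: Landau–Selberg–Delange expansion of R(x) = Σ_{k<A}
c_k x (log x)^{−1/2−k} + O(x(log x)^{−A−1/2}) (MontgomeryVaughan2007 §6.2.1 Ex. 21; Tenenbaum2015
II.5) transported to intervals of length x^{1−o(1)} by Huxley's zero-density estimate (Huxley1972) à
la Ramachandra 1976 (doi:10.4064/aa-31-4-313-324, coefficients of ζ(s)^{1/2}L(s,χ₄)^{1/2}F(s) in
short intervals); the smooth main terms differ by O(2^ℓ·2^{−s}/n) between the two intervals.
[difficulty: M] (why it might fail: precision n^{−A} for every A needs an exp(−c(log x)^δ) error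
term for ζ^{1/2}L(s,χ₄)^{1/2}-coefficients in intervals as short as x·2^{−(log₂x)^{3/5}}; printed
only for ζ^z-type coefficients (Ramachandra) and longer ranges.) [MontgomeryVaughan2007,
Tenenbaum2015, Huxley1972, doi:10.4064/aa-31-4-313-324, Hooley1976]
#9 DigitBlindAC0 (support) — THE BAND TRANSFER: TwoSquaresMinorArcs ∧ TwoSquaresShortIntervals ⇒
TwoSquaresEndOrthogonalAC0. Proof plan (s = ⌊n^{1/4}⌋): f = 1_{S₂} − m with m = conditional mean on
(bottom s bits, top s bits); for |S| ≤ (log n)^C: (a) S inside the two end bands ⇒ f̂(S) = 0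
exactly; (b) S with maximal non-top bit M, M + 1 ≤ ℓ − 3s for the current interval length 2^ℓ ⇒
expand w_{S∖top} on ℤ/2^{M+1} (Fourier L¹ ≤ (Cn)^{|S|}, all frequencies odd/2^{M+1}), split on top
pieces, apply crux 2; (c) near-top M ⇒ split into dyadic sub-intervals of length 2^M on which bit_M
is constant and recurse on S∖{M} (depth ≤ |S|, each level costs ≤ 3s in ℓ, so ℓ ≥ n − s − 3s(log
n)^C ≥ n − n^{3/5}); clustered S on which w_S is constant over sub-intervals are killed by
short-interval regularity (crux 4); then Σ_{|S|≤k}|F̂(S)||f̂(S)| ≤ (Σ_{|S|≤k} f̂(S)²)^{1/2} ≤ 2ⁿ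
n^{−A} and Tal's tail bound (tree: `ACForm.tailWeight_le_tailBound`, `Circuit.l1Level_acBasis_le`)
with k = (log n)^{d+2}. Generalises the banked `MobiusLadder.ac0_orthogonal_of_uniform_walsh` (which
needs a UNIFORM 2^{n−n^c} Walsh bound that biased/sparse witnesses cannot satisfy) — the L²/banded
variant is the reusable lemma this route adds. Risk: the clustered near-top recursion may need
regularity on intervals shorter than 2^{n−n^{3/5}} or AP-regularity mod 2^j beyond the conditioned
bits (both in print via characters mod 2^j, no exceptional zeros) — then file that input as a
further support; the Vaaler/Erdős–Turán remainders for products of |S| square waves need their own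
minor-arc majorant. [difficulty: M] [Green2012, Tal2017, LinialMansourNisan1993,
Bourgain2013MoebiusWalsh, ODonnell2014]
#9 TwoSquaresFloor (support) — LANDAU FLOOR, elementary second-moment form (no L-functions): #(S₂ ∩
[2^{n−1}, 2ⁿ)) ≥ c·2ⁿ/n³ eventually (Cauchy–Schwarz on r(N) = #{(a,b): a²+b² = N} with Σ r ≍ x and Σ
r² ≤ #{(a,b,c,d): (a−c)(a+c) = (d−b)(d+b)} ≪ x log³x). [difficulty: provable-now]
[MontgomeryVaughan2007, Landau1918]
#9 TwoSquaresNotAC0 (support) — CLASS GLUE, elementary: R0ᶜ ⇒ S₂ ∉ AC⁰. If an AC⁰ family decided S₂,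
F = 1 − 2·1_{S₂} gives |Σ (1_{S₂} − m)F| = 2·Σ m(1 − m) ≥ (#S₂ ∩ [2^{n−1},2ⁿ))·(1 − max m) and max m
≤ 0.499 by a FINITE sieve (primes ≡ 3 (4) up to 79, CRT in APs mod 2^{s} ∩ pieces of length
2^{n−2s}), contradicting n^{−A} via TwoSquaresFloor. Pattern = MobiusLadder.LiouvilleNotAC0
(banked), sparse-witness version. [difficulty: provable-now] [Green2012, AroraBarak2009]
#9 TwoSquaresInProgressions (support) — DENSITY IN PLANTING PROGRESSIONS (in print in substance:
Iwaniec's half-dimensional sieve lower bound with level of distribution exact for APs; for N ≡ 1 (4)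
"no prime ≡ 3 (4) below √N divides N" already forces N ∈ S₂): there is c > 0 such that eventually in
n, for m ∈ {1, 9, 49}, 2 ≤ K ≤ n/4, r < m·2^K with r ≡ 1 (4) and gcd(r, m) = 1: #{t < 2ⁿ : m·2^K·t +
r ∈ S₂} ≥ c·2ⁿ/√n. [difficulty: M] [doi:10.4064/aa-29-1-69-95, FriedlanderIwaniecOperaDeCribro2010,
MontgomeryVaughan2007]
#9 PlantedModRung (support) — R1 BY PLANTING (Allender–Saks–Shparlinski transplanted from
SQUAREFREE/PRIMES to S₂): Smolensky's theorem for the languages MOD_q (strings whose number of ones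
is divisible by q) against AC⁰[p], p ≠ q primes, together with TwoSquaresInProgressions, gives S₂ ∉
AC⁰[p] for EVERY prime p. Gadget (pure wiring inside AC⁰[p]): on m = ⌊√n'⌋ input bits x, N(x, P) =
9·2^K·P + 1 + Σᵢ xᵢ 2^{6i} (K = 6m + 6; 2⁶ ≡ 1 mod 9, so N ≡ 1 + |x| mod 9 and N ≡ 1 mod 4) with T =
m·n' HARD-WIRED paddings P and an OR on top: if 1 + |x| ≡ 3, 6 (9) then 3 ∥ N and every copy
rejects; otherwise each copy accepts with probability ≥ c/√n' over P (the density support, cases gcd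
= 1 and 9 ∣ r via m = 1), so some fixed padding tuple is correct on all x (Adleman); six shifted
ANDs isolate a residue mod 9, giving MOD₃ ∈ AC⁰[p] — contradiction for p ≠ 3; for p = 3 plant 7 ∥ N
with 49·2^K and 2^{21} ≡ 1 (mod 49). Reusable verbatim by every witness that rejects a congruence
class mod an odd prime power (IQ3 rejects 9 ∣ d; KS, L_W are sets of primes). [difficulty: M]
[AllenderSaksShparlinski2001, doi:10.1007/pl00001600, doi:10.1007/3-540-49116-3_4, Smolensky1987,
Razborov1987, Jukna2012]
#9 TwoSquaresMemBQP (support) — S₂ ∈ BQP: run the discharged FBQP factoring family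
(`Literature.Computability.Cryptography.factoring_mem_FBQP_holds`), post-process the prime-factor
list with the Fermat–Euler criterion `Nat.eq_sq_add_sq_iff` (every prime ≡ 3 mod 4 occurs to an even
power) in FP, read one wire — verbatim the banked `MobiusLadder.liouvilleMemBQP_of_factoring` with a
different CodeFP post-processor. [difficulty: provable-now] [Shor1997, BernsteinVazirani1997,
Watrous2009]
#9 BlumFaceGivesTarget (support) — THE NAMED FACE OF THE TOP: if no BPP language separates anti-Blum
semiprimes {pq : p ≡ q ≡ 1 (4)} from Blum integers {pq : p ≡ q ≡ 3 (4)} (the promise problem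
"recognise a Blum integer", for which zero-knowledge proofs were invented because it cannot be
checked — van de Graaf–Peralta 1987), then S₂ ∉ BPP: pq with p ≡ q ≡ 1 (4) is a sum of two squares
(Fermat + Brahmagupta–Fibonacci), pq with p ≡ q ≡ 3 (4) is not (odd exponent), so S₂ itself would
separate them. [difficulty: provable-now] [doi:10.1007/3-540-48184-2_9, doi:10.1137/0215025,
GoldwasserMicaliRivest1988]

TWO-LAYER PLAN. TwoSquaresMinorArcs ⇐ OmegaTruncation (tail of Ω(N) > n^{1/3} on intervals) →
PrimeTupleTypeI (a prime ≥ 2^{2ℓ/3}) → PrimeTupleTypeII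
(sub-product in [2^{ℓ/3}, 2^{2ℓ/3}]) → TwoSquaresMinorArcs. DigitBlindAC0 ⇐ BandedWalshL2 (generic:
any bounded f with piecewise minor-arc +
short-interval inputs) → SquareWaveExpansion → DigitBlindAC0. Next witness on the same engine
(separate route if R0ᶜ lands): the genus face
g(pq) = (p/q) on semiprimes p ≡ q ≡ 1 (4) (= 4-rank one of Cl(ℚ(√pq))), whose balanced range needs
Heath-Brown's quadratic large sieve and
mixed Burgess bounds (Heath-Brown–Pierce / Kerr) — deliberately NOT filed now.

KILL CRITERIA. (i) A classical polynomial-time test for S₂ (equivalently for "the 3-mod-4 part of N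
is a square", or a Blum-recogniser) refutes X: close
`refuted:TwoSquaresNotBPP`; the rungs R0ᶜ/R1 survive as theorems about a P-language (informative: it
would be the first factoring-type predicate
decided without factoring). (ii) TwoSquaresMinorArcs refuted by a dyadic-frequency bias of S₂ on
long intervals (a structured counterexample
would itself be a theorem about digits of sums of two squares): demote R0ᶜ to the end-junta rung,
keep R1 (planting does not use minor arcs).
(iii) A proof that DigitBlindAC0 needs AP-regularity beyond √n conditioned bits: add that input as a
support (in print via characters mod 2^j,
no exceptional zeros), not a kill. (iv) If Bernasconi–Damm–Shparlinski / Allender–Saks–Shparlinski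
already treat S₂ (novelty audit owed, APIs
rate-limited this session): R1 becomes `known`, R0ᶜ (correlation form with end-conditioning) stays;
route continues on cruxes 2–4.

NOT DECOMPOSED YET. The TC⁰ rung (S₂ ⊥ TC⁰ after conditioning on N mod Π_{p ≤ n^{log n}} p-type
data, or on rough N: breakthrough-type, E ⊄ TC⁰-strength, left
to refuters as for MobiusLadder's LiouvilleOrthogonalTC0); the average-case Blum face (advantage ε
over 1/2 on random semiprimes ≡ 1 (4)) and its
transfer lemma (ArithStatLadder's NotBPPOfAvgFace pattern); the generic statement of PlantedModRung
for arbitrary obstruction classes (provers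
may prove the S₂ instance first and generalise with --supports); the CodeFP post-processor for the
Fermat–Euler criterion; quantitative
(2^{−n^c}) forms of R0ᶜ.

CHEAPEST FALSIFIER. A 40-line numpy check a refuter can run today: for n = 20…26, tabulate max over
odd T and j ∈ [⌊√n⌋, n − 2⌊√n⌋] of
|Σ_{N<2ⁿ} 1_{S₂}(N) e(TN/2^j)| / #S₂(2ⁿ) — the route predicts ≈ 2^{−(j−1)} (2-adic) for small j and
≲ 2^{−(ℓ−j)} (odd-major leakage) for
large j, noise in between; a plateau ABOVE both envelopes at some middle j kills
TwoSquaresMinorArcs. RUN this session at n = 20 (pure-python exact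
FFT, compute/s2_dyadic_bias_pure.py): j = 2…9 give 0.49, 0.25, 0.13, 0.066, 0.035, 0.018, 0.0096,
0.0055 (≈ 2^{1−j}); j = 12…16 give 0.0022,
0.0032, 0.0062, 0.012, 0.021 with maximisers T/2^j ≈ 1/9·?, 60/107, 17/49, 35/81, 32/49 (odd-major,
≈ 0.35·2^{−(ℓ−j)}); floor 2.2e-3 ≈ noise —
mechanism alive, and the observed envelopes are exactly the two the band [s, ℓ − 3s] excludes. Also
done in head: the 2-adic class weight has Fourier
coefficient (e(T/4) − 1)/2^j at odd T (no hidden main term); the finite sieve bound max-density ≤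
0.499 in APs mod 2^j uses primes ≡ 3 (4) up to 79 (product 0.498). Literature kill:
an abstract of doi:10.1007/pl00001600 or AllenderSaksShparlinski2001 listing "sums of two squares"
(owed; S2/OpenAlex/zbMATH rate-limited).

NUMBERS. Landau: #S₂(x) ~ K x/√log x, K = 0.7642… (Landau–Ramanujan constant); density of S₂ among
n-bit integers ≈ 0.92/√n. Band parameter s = ⌊n^{1/4}⌋: all savings are 2^{−Ω(n^{1/4})}, against the
quasi-polynomial
(Cn)^{(log n)^C} losses of the Walsh bookkeeping. Boppana/Tal: depth-d size-σ
AC⁰ has Fourier tail ≤ 2·2^{−k/O(log σ)^{d−1}} above level k and level-ℓ L¹ mass ≤ (C log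
σ)^{(d−1)ℓ} (tree, proved). Planting: ord₉(2) = 6,
ord₄₉(2) = 21; gadget uses K = 6m + 6 ≤ n/4 digits for m = ⌊√n⌋ inputs and T = m·n paddings.
Smolensky: MOD_q needs AC⁰[p] size 2^{Ω(m^{1/2d})}
(Jukna2012 Thm 12.27). Items at open: 12 (target + 3 cruxes, 7 supports, 1 assembly).

DEFINITION REQUESTS. None needed to open: AC0, AC0Mod, Circuit, acBasis, sgn, BPP, BQP,
PromiseProblem.ofEncoding, PromiseBPP, encodingNatBool.toLanguage all exist;
Smolensky for MOD_q (q ≠ 2) is carried as an explicit hypothesis of PlantedModRung (tree has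
`smolensky_parity` for q = 2 only) — a cite item
`fact: MOD_q ∉ AC⁰[p] for distinct primes (Smolensky 1987 Thm 2; Jukna2012 §12.6)` will be filed
after open.

Novelty: Searches (2026-08-16): `lit frontier QuantumAdvantage --since 2022` (30 rows; none on S₂, digits or
AC⁰); `lit bridges QuantumAdvantage --cross any`
(30 rows; none); `lit search --source s2 "average sensitivity square-free numbers Boolean circuit
bounded depth"` (9: BDS 1999/2000, Bernasconi–Shparlinski
STACS'99, Kabanets–Kane–Lu 2017 — all SQUAREFREE); `lit search --source crossref "Allender Saks
Shparlinski lower bound for primality"` (found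
doi:10.1006/jcss.2000.1725, not held, acq-01278/06221 filed); `lit search --source zbmath
"Bernasconi Shparlinski circuit complexity testing square-free
numbers" --reviews` (3, reviews licence-blocked); `lit search --source arxiv "sums of two squares
circuit complexity"` (0), `"sums of two squares digits"`
(0/timeout); `lit galaxy search "average sensitivity of square" --star all` (1: weighted-sum
function arXiv:1412.6268); `lit galaxy search "square-free"
--star panama --author-contains Shparlinski` (2 books, neither the 2003 monograph); held-book reads:
Jukna2012 pp. 350–358 (Boppana Thm 12.13/Cor 12.14,
Smolensky Thm 12.27 + MOD_m remark), MontgomeryVaughan2007 §6.2.1 Ex. 21 (Landau contour, error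
x·exp(−c√log x)), Harman2007 Thm 2.1/Lemmas 2.3–2.6,
Buhler–Stevenhagen 2008 Ex. 4; all 30 open QuantumAdvantage cards grepped for two squares / Blum /
sensitivity / Smolensky / AC0[ (hits only in
MobiusLadder-engine cards: katai-transfer-digital-rungs-v2, kummer-digital-ladders); 50 route files
read via `ledger workitem get`. OpenAlex dail  [refs: 10.1006/jcss.2000.1725, 10.1007/pl00001600, 10.1007/3-540-49116-3_4, 1412.6268, doi:10.1006/jcss.2000.1725, doi:10.1007/pl00001600, doi:10.1007/3-540-49116-3_4, Jukna2012, MontgomeryVaughan2007, Harman2007, Green2012, AllenderSaksShparlinski2001]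

Barriers (technique_class: correlation-bounds, circuit-lower-bounds, planting): - technique_class: correlation-bounds, circuit-lower-bounds, planting
- Literature.Barriers.QuantumAdvantage.NaturalProofs: not engaged below TC⁰ — R0ᶜ/R1 concern AC⁰ and
AC⁰[p], which contain no PRF candidates, and both proofs are NON-natural in kind (R0ᶜ uses the
prime-tuple structure of one explicit set, a 2^{−Ω(2ⁿ)}-dense property; R1 is a reduction from
MOD_q, i.e. Smolensky's algebraic property, useful against AC⁰[p] only); it WOULD engage a
TC⁰/P-poly rung, which the route files for refuters only (Not decomposed yet).
- Literature.Barriers.QuantumAdvantage.SeparationPrerequisites: applies to X only (X ⇒ summit ⇒ PP ⊄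
BPP, P ≠ PSPACE via `not_PP_subset_BPP_of_witness`); NOT evaded — X is hypothesis-type and never
staffed; the rungs imply no uniform class separation (AC⁰, AC⁰[p] ⊉ P is known).
- Literature.Barriers.QuantumAdvantage.Relativization: not engaged — every rung is an unrelativized
statement about one explicit arithmetic set against an explicit circuit class; the top inherits the
barrier exactly as FACT ∉ BPP does (contrary oracles exist for BQP vs BPP), which is why it is a
hypothesis.
- Literature.Barriers.QuantumAdvantage.Algebrization: same status as Relativization (rungs explicit,
top hypothesis-type).
- Literature.Barriers.QuantumAdvantage.TotalFunctionSpeedupLimit: S₂ is a TOTAL language but the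
speed-up is white-box arithmetic (Shor on the numeral), not a query speed-up on a total Boolean
function; Beals et al. Thm 5.4 does not apply.
- Negatives index:

History (route lifecycle, newest last):
- 2026-08-16T16:16:29Z · AUTO-CRUX (open): TwoSquaresNotBPP — hypotheses of the deciding theorem that nothing in the route derives are cruxes (planner-plan-lens-QuantumAdvantage-recomb-v2-0)
- 2026-08-26T13:38:34Z · DORMANT — reconciler: no traction for 7 d (last activity item-proof-filed at 2026-08-19T12:40:33Z); parked, not closed — `ledger route dormant route-QuantumAdvantage-TwoS (operator:999:3053169)

sub-problem: QuantumAdvantage · status: dormant · opened planner-plan-lens-QuantumAdvantage-recomb-v2-0 2026-08-16T16:15:50Z · rev 4 · ledger route-QuantumAdvantage-TwoSquaresLadder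
GENERATED by the gate from the ledger (D-0016/17). Provers cite these decls: `theorem foo : Summit.QuantumAdvantage.QuantumAdvantage.Theses.TwoSquaresLadder.<Decl> := …` in Summits/QuantumAdvantage/QuantumAdvantage/Theorems/<Name>.lean.
-/

namespace Summit.QuantumAdvantage.QuantumAdvantage.Theses.TwoSquaresLadder

open scoped BigOperators Topology Manifold Classical MeasureTheory ProbabilityTheory Matrix InnerProductSpace ComplexConjugate ContinuousMap
open Filter Set Function TopologicalSpace MeasureTheory

attribute [summit_statement] _root_.QuantumAdvantage

open Literature.QuantumAdvantage

/-- item stmt-QuantumAdvantage-16057 · crux (kind.auto-crux: conjecture-grade) · rank 0 · open · by planner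
why it might fail: may simply be FALSE: a factoring-free test for "the 3-mod-4 part of N is a square" (none since Fermat; Cornacchia needs √−1 mod N) would put S₂ in P; no reduction FROM factoring/QR is known either.
sources: doi:10.1007/3-540-48184-2_9, doi:10.1017/9781139049801, AdlemanMcCurley1994, Shor1997
[target] the language of sums of two squares (LSB-first canonical numerals) is not in BPP.
Hypothesis-type top (like LiouvilleNotPPoly, IqThreeNotBPP); implied by Blum-integer-recognition
hardness (support BlumFaceGivesTarget); S₂ ≤ FACT, so it implies factoring ∉ FBPP. [difficulty:
open-problem] -/
@[route_item "route-QuantumAdvantage-TwoSquaresLadder", crux]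
def TwoSquaresNotBPP : Prop :=
  Computability.encodingNatBool.toLanguage {N : ℕ | ∃ a b : ℕ, N = a ^ 2 + b ^ 2} ∉ Literature.Computability.Complexity.BPP

/-- item stmt-QuantumAdvantage-16058 · crux · rank 2 · open · by planner
why it might fail: regime (c) needs SHORT-INTERVAL type I/II bounds (L = x·2^{−n^{3/5}}) uniform over ≤ n^{1/3}-fold prime tuples with (log x)^{O(n^{1/3})} configurations against a 2^{−n^{1/4}} target; regime (a) needs Postnikov–Gallagher zero-free regions for (L(s,χ)L(s,χχ₄))^{1/2}, χ mod 2^j.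
sources: Harman2007, Vaughan1977, MontgomeryVaughan2007, doi:10.1007/BF01425492, Green2012, Bourgain2013MoebiusWalsh
[crux] MIDDLE-BAND DYADIC FREQUENCIES OF S₂ ON LONG DYADIC INTERVALS (s := ⌊n^{1/4}⌋ = Nat.sqrt
(Nat.sqrt n)). There is c > 0 such that for all large n, every dyadic interval I = [a·2^ℓ,
(a+1)·2^ℓ) ⊆ [0, 2ⁿ) with n − n^{3/5} ≤ ℓ ≤ n, and every frequency T/2^j with T odd and s ≤ j ≤ ℓ −
3s: |Σ_{N∈I} 1_{S₂}(N) e(TN/2^j)| ≤ 2^ℓ · 2^{−n^c} (proof target: 2^{−s}). Three regimes: (a)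
dyadic-major s ≤ j ≤ 4s: classes mod 2^j, the 2-adic main term vanishes at odd T beyond O(2^{ℓ−j})
(class weight transform (e(T/4) − 1)/2^j), errors via characters mod 2^j — no exceptional zeros,
Postnikov–Gallagher regions give relative error 2^{4s}·exp(−c n^{1/3−ε}) → 0; (b) odd-major:
Dirichlet a/q' with q' ≤ 2^{4s}: main + possible Siegel term bounded by √q'·2^{j−ℓ} ≤ 2^{−s} through
the winding of e(βN) (Landau–Page structure only); (c) minor q' > 2^{4s}: truncate Ω(N) ≤ n^{1/3}
(tail 2^{−n^{1/3}+o}), survivors = ordered prime tuples with the S₂ parity condition (≤ (log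
x)^{O(n^{1/3})} configurations), each bounded by short-interval type I/II (Heath-Brown/Vaughan
identity on [A, A+L), L = x^{1−o(1)}: no A/L loss), saving q'^{−1/4} ≤ 2^{−s}. Numerics this session
(n = 20, all odd T, exact FFT): max relati -/
@[route_item "route-QuantumAdvantage-TwoSquaresLadder"]
def TwoSquaresMinorArcs : Prop :=
  ∃ c : ℝ, 0 < c ∧ ∀ᶠ n : ℕ in Filter.atTop, ∀ ℓ j T a : ℕ, Nat.sqrt (Nat.sqrt n) ≤ j → j + 3 * Nat.sqrt (Nat.sqrt n) ≤ ℓ → n ≤ ℓ + ⌊(n : ℝ) ^ ((3 : ℝ) / 5)⌋₊ → ℓ ≤ n → Odd T → (a + 1) * 2 ^ ℓ ≤ 2 ^ n → ‖∑ N ∈ Finset.Ico (a * 2 ^ ℓ) ((a + 1) * 2 ^ ℓ), (Set.indicator {N : ℕ | ∃ u v : ℕ, N = u ^ 2 + v ^ 2} (fun _ => (1 : ℂ)) N) * Complex.exp (2 * Real.pi * Complex.I * (T : ℂ) * (N : ℂ) / (2 : ℂ) ^ j)‖ ≤ (2 : ℝ) ^ ℓ * (2 : ℝ) ^ (-((n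 : ℝ) ^ c))

/-- item stmt-QuantumAdvantage-16059 · crux · rank 3 · open · by planner
why it might fail: could be FALSE only through a digital bias of S₂ at a middle-band dyadic frequency (none seen at n = 20); provability rests on cruxes 2, 4 and the banded L² transfer (clustered near-top characters recurse |S| ≤ (log n)^C times).
sources: Green2012, Tal2017, Boppana1997
[crux] R0ᶜ, THE EARNED THEOREM (target of the analytic engine: support DigitBlindAC0 derives it from
cruxes 2 and 4; a prover may also attack it directly): for every A, depth d and size polynomial p,
eventually in n, every AC⁰ circuit C on n digits has |Σ_{N<2ⁿ} (1_{S₂}(N) − m_n(N))·sgn C(bits N)| ≤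
2ⁿ n^{−A}, where m_n(N) is the proportion of sums of two squares among the N' < 2ⁿ sharing N's
bottom s and top s binary digits, s = ⌊n^{1/4}⌋ (Nat.sqrt (Nat.sqrt n)): AC⁰ cannot predict S₂
beyond its end digits. [deps: TwoSquaresMinorArcs, TwoSquaresShortIntervals] [difficulty: L] -/
@[route_item "route-QuantumAdvantage-TwoSquaresLadder"]
def TwoSquaresEndOrthogonalAC0 : Prop :=
  ∀ A d : ℕ, ∀ p : Polynomial ℕ, ∀ᶠ n : ℕ in Filter.atTop, ∀ C : Literature.Computability.Complexity.Circuit (Fin n), C.IsOver Literature.Computability.Complexity.acBasis → C.acDepth ≤ d → C.size ≤ p.eval n → |∑ N ∈ Finset.range (2 ^ n), ((Set.indicator {N : ℕ | ∃ u v : ℕ, N = u ^ 2 + v ^ 2} (fun _ => (1 : ℝ)) N) - ((((Finset.range (2 ^ n)).filter (fun N' => N' % 2 ^ Nat.sqrt (Nat.sqrt n) = N % 2 ^ Nat.sqrt (Nat.sqrt n) ∧ N' / 2 ^ (n - Nat.sqrt (Nat.sqrt n)) = N / 2 ^ (n - Nat.sqrt (Nat.sqrt n)) ∧ ∃ u v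 : ℕ, N' = u ^ 2 + v ^ 2)).card : ℝ) / (2 : ℝ) ^ (n - 2 * Nat.sqrt (Nat.sqrt n)))) * Literature.Probability.RandomGraphs.LowDegree.sgn (C.eval fun i : Fin n => N.testBit i)| ≤ (2 : ℝ) ^ n / (n : ℝ) ^ A

/-- item stmt-QuantumAdvantage-16060 · crux · rank 4 · open · by planner
why it might fail: precision n^{−A} for every A needs an exp(−c(log x)^δ) error term for ζ^{1/2}L(s,χ₄)^{1/2}-coefficients in intervals as short as x·2^{−(log₂x)^{3/5}}; printed only for ζ^z-type coefficients (Ramachandra) and longer ranges.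
sources: MontgomeryVaughan2007, Tenenbaum2015, Huxley1972, doi:10.4064/aa-31-4-313-324, Hooley1976
[crux] SHORT-INTERVAL REGULARITY OF LANDAU'S COUNT: for every A, eventually in n, any two dyadic
intervals of equal length 2^ℓ ≥ 2^{n−n^{3/5}} inside [2^{n−1}, 2ⁿ) at distance ≤ 2^{n−s} (s =
⌊n^{1/4}⌋, i.e. inside one top piece) contain the same number of sums of two squares up to
2^ℓ·n^{−A}. In print in spirit: Landau–Selberg–Delange expansion of R(x) = Σ_{k<A} c_k x (log
x)^{−1/2−k} + O(x(log x)^{−A−1/2}) (MontgomeryVaughan2007 §6.2.1 Ex. 21; Tenenbaum2015 II.5)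
transported to intervals of length x^{1−o(1)} by Huxley's zero-density estimate (Huxley1972) à la
Ramachandra 1976 (doi:10.4064/aa-31-4-313-324, coefficients of ζ(s)^{1/2}L(s,χ₄)^{1/2}F(s) in short
intervals); the smooth main terms differ by O(2^ℓ·2^{−s}/n) between the two intervals. [difficulty:
M] -/
@[route_item "route-QuantumAdvantage-TwoSquaresLadder"]
def TwoSquaresShortIntervals : Prop :=
  ∀ A : ℕ, ∀ᶠ n : ℕ in Filter.atTop, ∀ ℓ a a' : ℕ, n ≤ ℓ + ⌊(n : ℝ) ^ ((3 : ℝ) / 5)⌋₊ → ℓ + Nat.sqrt (Nat.sqrt n) ≤ n → 2 ^ (n - 1) ≤ a * 2 ^ ℓ → a ≤ a' → (a' + 1) * 2 ^ ℓ ≤ 2 ^ n → (a' - a) * 2 ^ ℓ ≤ 2 ^ (n - Nat.sqrt (Nat.sqrt n)) → |(((Finset.Ico (a * 2 ^ ℓ) ((a + 1) * 2 ^ ℓ)).filter (fun N => ∃ u v : ℕ, N = u ^ 2 + v ^ 2)).card : ℝ) - (((Finset.Ico (a' * 2 ^ ℓ) ((a' + 1) * 2 ^ ℓ)).filter (fun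 N => ∃ u v : ℕ, N = u ^ 2 + v ^ 2)).card : ℝ)| ≤ (2 : ℝ) ^ ℓ / (n : ℝ) ^ A

/-- item stmt-QuantumAdvantage-17738 · crux · rank 5 · closed · proved by Summit.QuantumAdvantage.QuantumAdvantage.Theorems.TwoSquaresLadder.twoSquaresBitCorrect_proof (prover) · by planner
why it might fail: Not truth (Fermat–Euler is Mathlib's Nat.eq_sq_add_sq_iff): can only stall on the List.count ↔ padicValNat bookkeeping and the canonical-numeral (encodeNat ∘ bitsToNat) round trip for non-canonical strings.
sources: Nat.eq_sq_add_sq_iff, Nat.primeFactorsList_count_eq, AroraBarak2009, Summit.QuantumAdvantage.QuantumAdvantage.Theorems.MobiusLadder.liouvilleBit_eq_true_iff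
[piece X₂ of the split of TwoSquaresMemBQP; provable-now, pure arithmetic + encodings] THE ANSWER
BIT DECIDES S₂: for every string x, [x is a canonical numeral ∧ every prime ≡ 3 (mod 4) has even
multiplicity in primeFactorsList (decodeNat x)] = true ↔ x ∈ L(S₂) = encodingNatBool '' {N : N = a²
+ b²}. Plan (registered skeleton Lines/birth.lean): Fermat–Euler on the factor LIST (Mathlib
`Nat.eq_sq_add_sq_iff` — every q ∈ primeFactors N with q % 4 = 3 has Even (padicValNat q N) —
transported by `Nat.primeFactorsList_count_eq` + `Nat.factorization_def`, N = 0 included: [] passes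
and 0 = 0² + 0²) and the generic canonical-numeral transfer ([encodeNat (bitsToNat x) = x] ∧
decodeNat x ∈ S ↔ x ∈ encodingNatBool.toLanguage S, pattern
`Theorems.MobiusLadder.liouvilleBit_eq_true_iff`). [difficulty: provable-now] -/
@[route_item "route-QuantumAdvantage-TwoSquaresLadder", crux]
def TwoSquaresBitCorrect : Prop :=
  ∀ x : List Bool, (decide (Computability.encodeNat (Literature.Computability.Complexity.bitsToNat x) = x) && (Computability.decodeNat x).primeFactorsList.all (fun p => !decide (p % 4 = 3) || decide ((Computability.decodeNat x).primeFactorsList.count p % 2 = 0))) = true ↔ x ∈ Computability.encodingNatBool.toLanguage {N : ℕ | ∃ a b : ℕ, N = a ^ 2 + b ^ 2}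

-- `TwoSquaresBitCorrect` holds: proved by `Summit.QuantumAdvantage.QuantumAdvantage.Theorems.TwoSquaresLadder.twoSquaresBitCorrect_proof` (its module imports this route file, so no `_holds` link can be stated here).

/-- item stmt-QuantumAdvantage-17737 · crux · rank 6 · closed · proved by Summit.QuantumAdvantage.QuantumAdvantage.Theorems.TwoSquaresLadder.twoSquaresPostFP_proof (prover) · by planner
why it might fail: Not truth: pure CodeFP plumbing (all-with-context, rawCountNat, natMod, parseF robustness are all in the tree); can only stall on typed-algebra bookkeeping (context threading of the list into its own `all` predicate).
sources: AroraBarak2009, BernsteinVazirani1997, Literature.Computability.Complexity.CodeFP.rawCountNat, Literature.Computability.Cryptography.VDSOracle.codeFP_parseF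
[piece X₁ of the split of TwoSquaresMemBQP; provable-now, classical] THE FERMAT–EULER POST-PROCESSOR
IS POLYNOMIAL TIME: some g ∈ FP maps every pair ⟨x, code(F) ++ pad⟩ (input numeral x; the
self-delimiting Boolean code `encodingListNatBool.encode F` of a factor list F : List ℕ followed by
arbitrary padding, as written by an FBQP family) to the one-bit string [x is a canonical numeral ∧
every p ∈ F with p ≡ 3 (mod 4) occurs an even number of times in F]. Plan (registered skeleton
Lines/birth.lean): the list functional F ↦ F.all (p ↦ ¬(p % 4 = 3) ∨ count p F even) in the typed
CodeFP algebra (`CodeFP.all` with context + `CodeFP.rawCountNat` + `natMod`/`natEq`), the canonical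
test (pattern `Theorems.MobiusLadder.codeFP_isCanonical`), composed over `VDSOracle.codeFP_parseF ∘
sndF` and `fstF`, then `VDSOracle.encode_primeFactorsList_eq` + `parseF_certCode_append` to read F
off code(F) ++ pad. [difficulty: provable-now] -/
@[route_item "route-QuantumAdvantage-TwoSquaresLadder", crux]
def TwoSquaresPostFP : Prop :=
  ∃ g ∈ Literature.Computability.Complexity.FP, ∀ (x : List Bool) (F : List ℕ) (pad : List Bool), g (Literature.Computability.Complexity.boolPair x (Literature.Computability.Complexity.encodingListNatBool.encode F ++ pad)) = [decide (Computability.encodeNat (Literature.Computability.Complexity.bitsToNat x) = x) && F.all (fun p => !decide (p % 4 = 3) || decide (F.count p % 2 = 0))]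

-- `TwoSquaresPostFP` holds: proved by `Summit.QuantumAdvantage.QuantumAdvantage.Theorems.TwoSquaresLadder.twoSquaresPostFP_proof` (its module imports this route file, so no `_holds` link can be stated here).

/-- item stmt-QuantumAdvantage-16066 · crux · rank 9 · closed · proved by Summit.QuantumAdvantage.QuantumAdvantage.Theorems.TwoSquaresLadder.TwoSquaresMemBQP_proof @ 7b5e33560ed6 (prover) · by planner
why it might fail: Not truth (Shor + Fermat–Euler, factoring_mem_FBQP_holds is discharged) but the one non-hypothesis binder of closes: the CodeFP post-processor must express 'every prime ≡ 3 (mod 4) has even multiplicity in the factor list' and the uniform-family wrap must keep error ≤ 1/3; infrastructure can stall.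
sources: Shor1997, BernsteinVazirani1997, Watrous2009
[support] S₂ ∈ BQP: run the discharged FBQP factoring family
(`Literature.Computability.Cryptography.factoring_mem_FBQP_holds`), post-process the prime-factor
list with the Fermat–Euler criterion `Nat.eq_sq_add_sq_iff` (every prime ≡ 3 mod 4 occurs to an even
power) in FP, read one wire — verbatim the banked `MobiusLadder.liouvilleMemBQP_of_factoring` with a
different CodeFP post-processor. [difficulty: provable-now] -/
@[route_item "route-QuantumAdvantage-TwoSquaresLadder", crux]
def TwoSquaresMemBQP : Prop :=
  Computability.encodingNatBool.toLanguage {N : ℕ | ∃ a b : ℕ, N = a ^ 2 + b ^ 2} ∈ Literature.Computability.Cryptography.BQP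

-- `TwoSquaresMemBQP` holds: proved by `Summit.QuantumAdvantage.QuantumAdvantage.Theorems.TwoSquaresLadder.TwoSquaresMemBQP_proof` @ 7b5e33560ed6 (its module imports this route file, so no `_holds` link can be stated here).

/-- item stmt-QuantumAdvantage-16061 · support · rank 9 · open · by planner
sources: Green2012, Tal2017, LinialMansourNisan1993, Bourgain2013MoebiusWalsh, ODonnell2014
[support] THE BAND TRANSFER: TwoSquaresMinorArcs ∧ TwoSquaresShortIntervals ⇒
TwoSquaresEndOrthogonalAC0. Proof plan (s = ⌊n^{1/4}⌋): f = 1_{S₂} − m with m = conditional mean on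
(bottom s bits, top s bits); for |S| ≤ (log n)^C: (a) S inside the two end bands ⇒ f̂(S) = 0
exactly; (b) S with maximal non-top bit M, M + 1 ≤ ℓ − 3s for the current interval length 2^ℓ ⇒
expand w_{S∖top} on ℤ/2^{M+1} (Fourier L¹ ≤ (Cn)^{|S|}, all frequencies odd/2^{M+1}), split on top
pieces, apply crux 2; (c) near-top M ⇒ split into dyadic sub-intervals of length 2^M on which bit_M
is constant and recurse on S∖{M} (depth ≤ |S|, each level costs ≤ 3s in ℓ, so ℓ ≥ n − s − 3s(log
n)^C ≥ n − n^{3/5}); clustered S on which w_S is constant over sub-intervals are killed by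
short-interval regularity (crux 4); then Σ_{|S|≤k}|F̂(S)||f̂(S)| ≤ (Σ_{|S|≤k} f̂(S)²)^{1/2} ≤ 2ⁿ
n^{−A} and Tal's tail bound (tree: `ACForm.tailWeight_le_tailBound`, `Circuit.l1Level_acBasis_le`)
with k = (log n)^{d+2}. Generalises the banked `MobiusLadder.ac0_orthogonal_of_uniform_walsh` (which
needs a UNIFORM 2^{n−n^c} Walsh bound that biased/sparse witnesses cannot satisfy) — the L²/banded
variant is the reusable lemma this route adds. Ris -/
@[route_item "route-QuantumAdvantage-TwoSquaresLadder"]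
def DigitBlindAC0 : Prop :=
  TwoSquaresMinorArcs → TwoSquaresShortIntervals → TwoSquaresEndOrthogonalAC0

/-- item stmt-QuantumAdvantage-16062 · support · rank 9 · closed · proved by Summit.QuantumAdvantage.QuantumAdvantage.Theorems.TwoSquaresFloor.twoSquaresFloor_proof @ a0564dabf9b7 (prover) · by planner
sources: MontgomeryVaughan2007, Landau1918
[support] LANDAU FLOOR, elementary second-moment form (no L-functions): #(S₂ ∩ [2^{n−1}, 2ⁿ)) ≥
c·2ⁿ/n³ eventually (Cauchy–Schwarz on r(N) = #{(a,b): a²+b² = N} with Σ r ≍ x and Σ r² ≤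
#{(a,b,c,d): (a−c)(a+c) = (d−b)(d+b)} ≪ x log³x). [difficulty: provable-now] -/
@[route_item "route-QuantumAdvantage-TwoSquaresLadder"]
def TwoSquaresFloor : Prop :=
  ∃ c : ℝ, 0 < c ∧ ∀ᶠ n : ℕ in Filter.atTop, c * (2 : ℝ) ^ n / (n : ℝ) ^ 3 ≤ (((Finset.Ico (2 ^ (n - 1)) (2 ^ n)).filter (fun N => ∃ u v : ℕ, N = u ^ 2 + v ^ 2)).card : ℝ)

-- `TwoSquaresFloor` holds: proved by `Summit.QuantumAdvantage.QuantumAdvantage.Theorems.TwoSquaresFloor.twoSquaresFloor_proof` @ a0564dabf9b7 (its module imports this route file, so no `_holds` link can be stated here).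

/-- item stmt-QuantumAdvantage-16063 · support · rank 9 · open · by planner
sources: Green2012, AroraBarak2009
[support] CLASS GLUE, elementary: R0ᶜ ⇒ S₂ ∉ AC⁰. If an AC⁰ family decided S₂, F = 1 − 2·1_{S₂}
gives |Σ (1_{S₂} − m)F| = 2·Σ m(1 − m) ≥ (#S₂ ∩ [2^{n−1},2ⁿ))·(1 − max m) and max m ≤ 0.499 by a
FINITE sieve (primes ≡ 3 (4) up to 79, CRT in APs mod 2^{s} ∩ pieces of length 2^{n−2s}),
contradicting n^{−A} via TwoSquaresFloor. Pattern = MobiusLadder.LiouvilleNotAC0 (banked),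
sparse-witness version. [difficulty: provable-now] -/
@[route_item "route-QuantumAdvantage-TwoSquaresLadder"]
def TwoSquaresNotAC0 : Prop :=
  TwoSquaresEndOrthogonalAC0 → Computability.encodingNatBool.toLanguage {N : ℕ | ∃ a b : ℕ, N = a ^ 2 + b ^ 2} ∉ Literature.Computability.Complexity.AC0

/-- item stmt-QuantumAdvantage-16064 · support · rank 9 · open · by planner
sources: doi:10.4064/aa-29-1-69-95, FriedlanderIwaniecOperaDeCribro2010, MontgomeryVaughan2007
[support] DENSITY IN PLANTING PROGRESSIONS (in print in substance: Iwaniec's half-dimensional sieve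
lower bound with level of distribution exact for APs; for N ≡ 1 (4) "no prime ≡ 3 (4) below √N
divides N" already forces N ∈ S₂): there is c > 0 such that eventually in n, for m ∈ {1, 9, 49}, 2 ≤
K ≤ n/4, r < m·2^K with r ≡ 1 (4) and gcd(r, m) = 1: #{t < 2ⁿ : m·2^K·t + r ∈ S₂} ≥ c·2ⁿ/√n.
[difficulty: M] -/
@[route_item "route-QuantumAdvantage-TwoSquaresLadder"]
def TwoSquaresInProgressions : Prop :=
  ∃ c : ℝ, 0 < c ∧ ∀ᶠ n : ℕ in Filter.atTop, ∀ m K r : ℕ, (m = 1 ∨ m = 9 ∨ m = 49) → 2 ≤ K → 4 * K ≤ n → r < m * 2 ^ K → r % 4 = 1 → Nat.Coprime r m → c * (2 : ℝ) ^ n / Real.sqrt n ≤ (((Finset.range (2 ^ n)).filter (fun t => ∃ u v : ℕ, m * 2 ^ K * t + r = u ^ 2 + v ^ 2)).card : ℝ)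

/-- item stmt-QuantumAdvantage-16065 · support · rank 9 · open · by planner
sources: AllenderSaksShparlinski2001, doi:10.1007/pl00001600, doi:10.1007/3-540-49116-3_4, Smolensky1987, Razborov1987, Jukna2012
[support] R1 BY PLANTING (Allender–Saks–Shparlinski transplanted from SQUAREFREE/PRIMES to S₂):
Smolensky's theorem for the languages MOD_q (strings whose number of ones is divisible by q) against
AC⁰[p], p ≠ q primes, together with TwoSquaresInProgressions, gives S₂ ∉ AC⁰[p] for EVERY prime p.
Gadget (pure wiring inside AC⁰[p]): on m = ⌊√n'⌋ input bits x, N(x, P) = 9·2^K·P + 1 + Σᵢ xᵢ 2^{6i}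
(K = 6m + 6; 2⁶ ≡ 1 mod 9, so N ≡ 1 + |x| mod 9 and N ≡ 1 mod 4) with T = m·n' HARD-WIRED paddings P
and an OR on top: if 1 + |x| ≡ 3, 6 (9) then 3 ∥ N and every copy rejects; otherwise each copy
accepts with probability ≥ c/√n' over P (the density support, cases gcd = 1 and 9 ∣ r via m = 1), so
some fixed padding tuple is correct on all x (Adleman); six shifted ANDs isolate a residue mod 9,
giving MOD₃ ∈ AC⁰[p] — contradiction for p ≠ 3; for p = 3 plant 7 ∥ N with 49·2^K and 2^{21} ≡ 1
(mod 49). Reusable verbatim by every witness that rejects a congruence class mod an odd prime power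
(IQ3 rejects 9 ∣ d; KS, L_W are sets of primes). [difficulty: M] -/
@[route_item "route-QuantumAdvantage-TwoSquaresLadder"]
def PlantedModRung : Prop :=
  (∀ p q : ℕ, p.Prime → q.Prime → p ≠ q → {x : List Bool | x.count true % q = 0} ∉ Literature.Computability.Complexity.AC0Mod p) → TwoSquaresInProgressions → ∀ p : ℕ, p.Prime → Computability.encodingNatBool.toLanguage {N : ℕ | ∃ a b : ℕ, N = a ^ 2 + b ^ 2} ∉ Literature.Computability.Complexity.AC0Mod p

/-- item stmt-QuantumAdvantage-16067 · support · rank 9 · closed · proved by Summit.QuantumAdvantage.QuantumAdvantage.Theorems.BlumFaceGivesTarget.blumFaceGivesTarget_proof @ fe93b2334716 (prover) · by planner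
sources: doi:10.1007/3-540-48184-2_9, doi:10.1137/0215025, GoldwasserMicaliRivest1988
[support] THE NAMED FACE OF THE TOP: if no BPP language separates anti-Blum semiprimes {pq : p ≡ q ≡
1 (4)} from Blum integers {pq : p ≡ q ≡ 3 (4)} (the promise problem "recognise a Blum integer", for
which zero-knowledge proofs were invented because it cannot be checked — van de Graaf–Peralta 1987),
then S₂ ∉ BPP: pq with p ≡ q ≡ 1 (4) is a sum of two squares (Fermat + Brahmagupta–Fibonacci), pq
with p ≡ q ≡ 3 (4) is not (odd exponent), so S₂ itself would separate them. [difficulty: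
provable-now] -/
@[route_item "route-QuantumAdvantage-TwoSquaresLadder"]
def BlumFaceGivesTarget : Prop :=
  Literature.Computability.Complexity.PromiseProblem.ofEncoding Computability.encodingNatBool {N : ℕ | ∃ p q : ℕ, p.Prime ∧ q.Prime ∧ p ≠ q ∧ p % 4 = 1 ∧ q % 4 = 1 ∧ N = p * q} {N : ℕ | ∃ p q : ℕ, p.Prime ∧ q.Prime ∧ p ≠ q ∧ p % 4 = 3 ∧ q % 4 = 3 ∧ N = p * q} ∉ Literature.Computability.Complexity.PromiseBPP → TwoSquaresNotBPP

-- `BlumFaceGivesTarget` holds: proved by `Summit.QuantumAdvantage.QuantumAdvantage.Theorems.BlumFaceGivesTarget.blumFaceGivesTarget_proof` @ fe93b2334716 (its module imports this route file, so no `_holds` link can be stated here).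

/-- item stmt-QuantumAdvantage-17739 · support · rank 9 · closed · proved by Summit.QuantumAdvantage.QuantumAdvantage.Theorems.TwoSquaresLadder.twoSquaresMemBQPOfSubs_proof (prover) · by planner
sources: Shor1997, BernsteinVazirani1997, Watrous2009
[support — GLUE of the typed split of the closes-binder TwoSquaresMemBQP into its two classical
pieces; PROVED] TwoSquaresMemBQP_of_subs : TwoSquaresPostFP → TwoSquaresBitCorrect →
TwoSquaresMemBQP — the quantum seam: Shor's discharged `factoring_mem_FBQP_holds`, ONE classical
wrap (`isQSolvable_classicalWrap_holds`, Bernstein–Vazirani 1997 §8) with the FP post-processor of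
TwoSquaresPostFP, and decision from search (`mem_BQP_of_isQSolvable_bit`) with the answer bit of
TwoSquaresBitCorrect. Sorry-free, kernel-checked (axioms propext/Classical.choice/Quot.sound) file
TwoSquaresLadderTwoSquaresMemBQPSplit.lean attached as evidence on stmt-QuantumAdvantage-16066 by
the crux-strategist (Theorems/ is prover-only): a prover lands it verbatim as
Theorems/TwoSquaresLadderTwoSquaresMemBQPSplit.lean and closes this item with `fun h₁ h₂ =>
TwoSquaresMemBQP_of_subs h₁ h₂`. With it TwoSquaresMemBQP is DERIVED from the two pieces (BC2
redirect of unit cstrat-stmt-QuantumAdvantage-16066-r1; the structural `route edit --split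
TwoSquaresMemBQP` with the same children is recorded in Cruxes/TwoSquaresMemBQP/STRATEGY-CENSUS.md
for the seat's final cycle / the operator). [difficulty: proved-in-evidence -/
@[route_item "route-QuantumAdvantage-TwoSquaresLadder"]
def TwoSquaresMemBQPOfSubs : Prop :=
  TwoSquaresPostFP → TwoSquaresBitCorrect → TwoSquaresMemBQP

-- `TwoSquaresMemBQPOfSubs` holds: proved by `Summit.QuantumAdvantage.QuantumAdvantage.Theorems.TwoSquaresLadder.twoSquaresMemBQPOfSubs_proof` (its module imports this route file, so no `_holds` link can be stated here).

/-- item stmt-QuantumAdvantage-16068 · assembly · rank 1 · closed · proved by Summit.QuantumAdvantage.QuantumAdvantage.Theorems.TwoSquaresLadder.Assembly_proof @ 5644161946f9 (prover) · by planner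
sources: Shor1997, BernsteinVazirani1997
[assembly] TwoSquaresMemBQP → TwoSquaresNotBPP → QuantumAdvantage. -/
@[route_item "route-QuantumAdvantage-TwoSquaresLadder"]
def Assembly : Prop :=
  TwoSquaresMemBQP → TwoSquaresNotBPP → QuantumAdvantage

-- `Assembly` holds: proved by `Summit.QuantumAdvantage.QuantumAdvantage.Theorems.TwoSquaresLadder.Assembly_proof` @ 5644161946f9 (its module imports this route file, so no `_holds` link can be stated here).

/-! D-0027 §2.1 — DECIDING THEOREM (planner-authored via `route open/edit --closes-file`; by planner-plan-lens-QuantumAdvantage-recomb-v2-0 2026-08-16T16:15:50Z):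
its hypotheses are this route's items and its conclusion the sub-problem Statement (glue_lint), and it elaborates with this file. -/

@[closes "route-QuantumAdvantage-TwoSquaresLadder"] theorem closes (h₁ : TwoSquaresMemBQP) (h₂ : TwoSquaresNotBPP) : QuantumAdvantage := ⟨_, h₁, h₂⟩

end Summit.QuantumAdvantage.QuantumAdvantage.Theses.TwoSquaresLadder
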